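import Mathlib

/-!
# LitRankMaiArith — the arithmetic half of Murty's lower bound for the rank of a CM-type
(Mai 1989, Proposition 2, p.195)

Blind cell `pub-hodge-repro`, seat lit-2 (gen 5).  Mathlib only.  Everything here is the valuation
bookkeeping `(*)` of Mai's printed proof (store `paper:doi-10-1016-0022-314x-89-90025-5`,
p0004:L20–L78, p0005:L5–L13), which reads:

"If q is a sufficiently large prime, then τ induces an embedding [G ↪ GL_r(ℤ/qℤ)].  In particular,
let d = [K:ℚ]/2; then d ∣ |GL_r(ℤ/qℤ)| = q^{r(r−1)/2}(q^r − 1)(q^{r−1} − 1)⋯(q − 1).  (*)  Now let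
p^α ∥ d, p odd prime, and q be a primitive root mod p^a.  From (*) α ≤ ord_p(|GL_r(ℤ/qℤ)|) =
Σ_{i=1}^{r} ord_p(q^i − 1).  By our choice of q, ord_p(q^i − 1) = 0 if (p−1) ∤ i, = j + 1 if
i = i₀ p^j (p−1), (i₀, p) = 1.  Letting ω = ⌊r/(p−1)⌋, we have α ≤ Σ_{j=1}^{ω} ord_p(q^{j(p−1)} − 1)
≤ ω + ω/(p−1) ≤ pr/(p−1)².  Therefore r ≥ (p−1)²α/p for all odd prime p such that p^α ∥ d."

The primitive root is taken mod `p²` (enough for the count: `v_p(q^{(p−1)j} − 1) = 1 + v_p(j)` by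
the lifting-the-exponent lemma, `Nat.emultiplicity_pow_sub_pow`), it exists by the cyclicity of
`(ℤ/p²)ˣ` (`ZMod.isCyclic_units_of_prime_pow`) and Dirichlet's theorem on primes in arithmetic
progressions (`Nat.forall_exists_prime_gt_and_eq_mod`); the sum `Σ_{j≤ω} (1 + v_p(j)) = ω + v_p(ω!)`
is bounded by Legendre's formula (`sub_one_mul_padicValNat_factorial_lt_of_ne_zero`).

Main results: `Murty.murty_bound` (`p^α ∣ |GL_r(F_q)| ⟹ (p−1)² α ≤ p r`) and
`Murty.primitiveRoot_facts` (the three facts about a prime `q` congruent to a generator of `(ℤ/p²)ˣ`).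
No new named fact (D-0026); everything is proved.
-/

namespace HodgeRepro.Lit2.Murty

open Finset

/-- The `p`-adic valuation of `q^((p-1)j) - 1` is `1 + v_p(j)` (lifting the exponent), from the two
facts `v_p(q^(p-1) - 1) = 1` and `p ∤ q`. -/
theorem padicValNat_pow_sub_one_of_dvd (p : ℕ) [hp : Fact p.Prime] (hodd : Odd p) (q : ℕ)
    (hq : 2 ≤ q) (hpq : ¬ p ∣ q) (h2 : padicValNat p (q ^ (p - 1) - 1) = 1) (j : ℕ) (hj : j ≠ 0) :
    padicValNat p (q ^ ((p - 1) * j) - 1) = 1 + padicValNat p j := by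
  have hx : ¬ p ∣ q ^ (p - 1) := fun h => hpq (hp.out.dvd_of_dvd_pow h)
  have hq1 : 1 ≤ q ^ (p - 1) := Nat.one_le_pow _ _ (by omega)
  have hne : q ^ (p - 1) - 1 ≠ 0 := by
    intro h0
    have : padicValNat p (q ^ (p - 1) - 1) = 0 := by rw [h0]; simp
    omega
  have hxy : p ∣ q ^ (p - 1) - 1 := dvd_of_one_le_padicValNat (by omega)
  have key := Nat.emultiplicity_pow_sub_pow hp.out hodd hxy hx j
  rw [one_pow, ← pow_mul] at key
  have hne2 : q ^ ((p - 1) * j) - 1 ≠ 0 := by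
    have : 2 ≤ q ^ ((p - 1) * j) := by
      calc 2 ≤ q := hq
        _ = q ^ 1 := (pow_one q).symm
        _ ≤ q ^ ((p - 1) * j) := Nat.pow_le_pow_right (by omega)
              (Nat.one_le_iff_ne_zero.mpr (Nat.mul_ne_zero (by have := hp.out.two_le; omega) hj))
    omega
  have e1 : (padicValNat p (q ^ ((p - 1) * j) - 1) : ℕ∞) = 1 + padicValNat p j := by
    rw [padicValNat_eq_emultiplicity hne2, key, ← padicValNat_eq_emultiplicity hne,
      ← padicValNat_eq_emultiplicity hj, h2]
    push_cast
    rfl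
  exact_mod_cast e1

/-- `∑_{i<r} v_p(q^(i+1) - 1) = ω + v_p(ω!)` with `ω = r/(p-1)`, when `p ∣ q^i - 1` forces
`(p-1) ∣ i` and `v_p(q^(p-1) - 1) = 1`. -/
theorem sum_padicValNat_eq (p : ℕ) [hp : Fact p.Prime] (hodd : Odd p) (q : ℕ) (hq : 2 ≤ q)
    (hpq : ¬ p ∣ q)
    (h1 : ∀ i : ℕ, p ∣ q ^ i - 1 → (p - 1) ∣ i)
    (h2 : padicValNat p (q ^ (p - 1) - 1) = 1) (r : ℕ) :
    ∑ i ∈ range r, padicValNat p (q ^ (i + 1) - 1) =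
      r / (p - 1) + padicValNat p (Nat.factorial (r / (p - 1))) := by
  induction r with
  | zero => simp
  | succ r ih =>
    rw [sum_range_succ, ih]
    have hsd : (r + 1) / (p - 1) = r / (p - 1) + if (p - 1) ∣ r + 1 then 1 else 0 := Nat.succ_div
    by_cases hd : (p - 1) ∣ r + 1
    · rw [if_pos hd] at hsd
      obtain ⟨j, hj⟩ := hd
      have hp1 : 0 < p - 1 := by have := hp.out.two_le; omega
      have hj0 : j ≠ 0 := by rintro rfl; omega
      have hdiv : (r + 1) / (p - 1) = j := by rw [hj, Nat.mul_div_cancel_left _ hp1]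
      have hdiv' : r / (p - 1) + 1 = j := by omega
      rw [hsd, hdiv', hj, padicValNat_pow_sub_one_of_dvd p hodd q hq hpq h2 j hj0]
      obtain ⟨k, rfl⟩ : ∃ k, j = k + 1 := ⟨j - 1, by omega⟩
      have hk : r / (p - 1) = k := by omega
      rw [hk, Nat.factorial_succ, padicValNat.mul (by omega) (Nat.factorial_ne_zero k)]
      ring
    · rw [if_neg hd, add_zero] at hsd
      rw [hsd]
      have : padicValNat p (q ^ (r + 1) - 1) = 0 :=
        padicValNat.eq_zero_of_not_dvd fun h => hd (h1 _ h)
      omega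

/-- The valuation of a product of nonzero factors is the sum of the valuations. -/
theorem padicValNat_prod_range (p : ℕ) [Fact p.Prime] (f : ℕ → ℕ) (hf : ∀ i, f i ≠ 0) (r : ℕ) :
    padicValNat p (∏ i ∈ range r, f i) = ∑ i ∈ range r, padicValNat p (f i) := by
  induction r with
  | zero => simp
  | succ r ih =>
    rw [prod_range_succ, sum_range_succ, padicValNat.mul (Finset.prod_ne_zero_iff.mpr fun i _ => hf i)
      (hf r), ih]

/-- **Murty's inequality** (Mai 1989, proof of Prop. 2, p.195): if `p^α ∣ |GL_r(F_q)|` for a prime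
`q` which is a primitive root mod `p²` (encoded by `h1`, `h2`), then `(p-1)² α ≤ p r`. -/
theorem murty_bound (p : ℕ) [hp : Fact p.Prime] (hodd : Odd p) (q : ℕ) (hq : 2 ≤ q)
    (hpq : ¬ p ∣ q)
    (h1 : ∀ i : ℕ, p ∣ q ^ i - 1 → (p - 1) ∣ i)
    (h2 : padicValNat p (q ^ (p - 1) - 1) = 1) (r α : ℕ)
    (hdvd : p ^ α ∣ ∏ i : Fin r, (q ^ r - q ^ (i : ℕ))) :
    (p - 1) ^ 2 * α ≤ p * r := by
  have hp2 := hp.out.two_le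
  -- split the product
  have hsplit : ∏ i : Fin r, (q ^ r - q ^ (i : ℕ)) =
      (∏ i ∈ range r, q ^ i) * ∏ i ∈ range r, (q ^ (i + 1) - 1) := by
    rw [Fin.prod_univ_eq_prod_range (fun i => q ^ r - q ^ i) r,
      ← prod_range_reflect (fun i => q ^ (i + 1) - 1) r, ← prod_mul_distrib]
    refine prod_congr rfl fun i hi => ?_
    rw [mem_range] at hi
    have h1' : r - 1 - i + 1 = r - i := by omega
    rw [h1', Nat.mul_sub_one, ← pow_add]
    congr 2
    omega
  have hcop : Nat.Coprime (p ^ α) (∏ i ∈ range r, q ^ i) := by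
    apply Nat.Coprime.pow_left
    apply Nat.Coprime.prod_right
    intro i _
    exact Nat.Coprime.pow_right _ ((Nat.Prime.coprime_iff_not_dvd hp.out).mpr hpq)
  have hB : p ^ α ∣ ∏ i ∈ range r, (q ^ (i + 1) - 1) := by
    rw [hsplit] at hdvd
    exact hcop.dvd_of_dvd_mul_left hdvd
  have hf : ∀ i, q ^ (i + 1) - 1 ≠ 0 := fun i => by
    have : 2 ≤ q ^ (i + 1) := by
      calc 2 ≤ q := hq
        _ = q ^ 1 := (pow_one q).symm
        _ ≤ q ^ (i + 1) := Nat.pow_le_pow_right (by omega) (by omega)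
    omega
  have hBne : ∏ i ∈ range r, (q ^ (i + 1) - 1) ≠ 0 := prod_ne_zero_iff.mpr fun i _ => hf i
  have hα : α ≤ padicValNat p (∏ i ∈ range r, (q ^ (i + 1) - 1)) :=
    (padicValNat_dvd_iff_le hBne).mp hB
  rw [padicValNat_prod_range p _ hf r, sum_padicValNat_eq p hodd q hq hpq h1 h2 r] at hα
  have hωr : (p - 1) * (r / (p - 1)) ≤ r := Nat.mul_div_le r (p - 1)
  obtain ⟨s, hs⟩ : ∃ s, p = s + 1 := ⟨p - 1, by omega⟩
  have hs1 : p - 1 = s := by omega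
  rw [hs1] at hα hωr ⊢
  rw [hs]
  rcases Nat.eq_zero_or_pos (r / s) with h0 | hpos
  · rw [h0] at hα
    simp at hα
    subst hα
    simp
  · have hleg := sub_one_mul_padicValNat_factorial_lt_of_ne_zero p hpos.ne'
    rw [hs1] at hleg
    set ω := r / s
    set v := padicValNat p (Nat.factorial ω)
    calc s ^ 2 * α ≤ s ^ 2 * (ω + v) := Nat.mul_le_mul_left _ hα
      _ = s * (s * ω) + s * (s * v) := by ring
      _ ≤ s * (s * ω) + s * ω := by
          have : s * (s * v) ≤ s * ω := Nat.mul_le_mul_left _ hleg.le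
          omega
      _ = (s + 1) * (s * ω) := by ring
      _ ≤ (s + 1) * r := Nat.mul_le_mul_left _ hωr

/-- `(q : ZMod m)^n = 1 ↔ m ∣ q^n - 1` for `q ≥ 1`. -/
theorem zmod_pow_eq_one_iff (m n q : ℕ) (hq : 1 ≤ q) :
    ((q : ZMod m) ^ n = 1) ↔ m ∣ q ^ n - 1 := by
  have h1 : 1 ≤ q ^ n := Nat.one_le_pow _ _ hq
  rw [← ZMod.natCast_eq_zero_iff, Nat.cast_sub h1, Nat.cast_pow, Nat.cast_one, sub_eq_zero]

/-- From a prime `q` congruent mod `p²` to a generator `g` of `(ℤ/p²)ˣ` (`p` odd): `p ∤ q`,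
`p ∣ q^i - 1 → (p-1) ∣ i`, and `v_p(q^(p-1) - 1) = 1`.  (Mai p.195: "q be a primitive root
mod p^a", the valuation bookkeeping `(*)`.) -/
theorem primitiveRoot_facts (p : ℕ) [hp : Fact p.Prime] (hodd : Odd p) (g : (ZMod (p ^ 2))ˣ)
    (hg : ∀ x : (ZMod (p ^ 2))ˣ, x ∈ Subgroup.zpowers g) (q : ℕ)
    (hqg : (q : ZMod (p ^ 2)) = (g : ZMod (p ^ 2))) :
    ¬ p ∣ q ∧ (∀ i : ℕ, p ∣ q ^ i - 1 → (p - 1) ∣ i) ∧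
      padicValNat p (q ^ (p - 1) - 1) = 1 := by
  have hp2 := hp.out.two_le
  have hp3 : 3 ≤ p := by
    rcases hodd with ⟨k, hk⟩; omega
  haveI : NeZero (p ^ 2) := ⟨pow_ne_zero 2 hp.out.ne_zero⟩
  -- the order of `g`
  have hord : orderOf g = p * (p - 1) := by
    rw [orderOf_eq_card_of_forall_mem_zpowers hg, Nat.card_eq_fintype_card,
      ZMod.card_units_eq_totient, Nat.totient_prime_pow hp.out (by norm_num)]
    simp
  -- `p ∤ q`
  have hpq : ¬ p ∣ q := by
    intro hdvd
    have hu : IsUnit (q : ZMod (p ^ 2)) := by rw [hqg]; exact g.isUnit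
    rw [ZMod.isUnit_iff_coprime] at hu
    have : p ∣ Nat.gcd q (p ^ 2) := Nat.dvd_gcd hdvd (dvd_pow_self p two_ne_zero)
    rw [hu] at this
    exact hp.out.one_lt.ne' (Nat.dvd_one.mp this)
  have hq1 : 1 ≤ q := by
    rcases Nat.eq_zero_or_pos q with rfl | h
    · exact absurd (dvd_zero p) hpq
    · exact h
  -- powers of `q` in `ZMod (p^2)` are powers of the unit `g`
  have hpow : ∀ n : ℕ, ((q : ZMod (p ^ 2)) ^ n = 1) ↔ g ^ n = 1 := by
    intro n
    rw [hqg, ← Units.val_pow_eq_pow_val, Units.val_eq_one]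
  refine ⟨hpq, ?_, ?_⟩
  · -- `p ∣ q^i - 1 → (p-1) ∣ i`
    intro i hi
    have hcast : (p : ZMod (p ^ 2)) ∣ (q : ZMod (p ^ 2)) ^ i - 1 := by
      have h1 : 1 ≤ q ^ i := Nat.one_le_pow _ _ hq1
      have := (Nat.cast_dvd_cast (α := ZMod (p ^ 2)) hi)
      rwa [Nat.cast_sub h1, Nat.cast_pow, Nat.cast_one] at this
    have hsq := dvd_sub_pow_of_dvd_sub hcast 1
    rw [pow_one, one_pow, ← Nat.cast_pow, ZMod.natCast_self, zero_dvd_iff, sub_eq_zero,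
      ← pow_mul] at hsq
    rw [hpow] at hsq
    have hdv : orderOf g ∣ i * p := orderOf_dvd_of_pow_eq_one hsq
    rw [hord, mul_comm i p] at hdv
    exact Nat.dvd_of_mul_dvd_mul_left hp.out.pos hdv
  · -- `v_p(q^(p-1) - 1) = 1`
    have hne : (q : ZMod p) ≠ 0 := by
      rw [Ne, ZMod.natCast_eq_zero_iff]; exact hpq
    have hferm : p ∣ q ^ (p - 1) - 1 := by
      rw [← zmod_pow_eq_one_iff _ _ _ hq1]
      exact ZMod.pow_card_sub_one_eq_one hne
    have hnot : ¬ p ^ 2 ∣ q ^ (p - 1) - 1 := by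
      rw [← zmod_pow_eq_one_iff _ _ _ hq1, hpow]
      intro h
      have hdv : orderOf g ∣ p - 1 := orderOf_dvd_of_pow_eq_one h
      rw [hord] at hdv
      have := Nat.le_of_dvd (by omega) hdv
      have h3 : p * (p - 1) ≥ 3 * (p - 1) := Nat.mul_le_mul_right _ hp3
      omega
    have hne0 : q ^ (p - 1) - 1 ≠ 0 := by
      intro h0; rw [h0] at hnot; exact hnot (dvd_zero _)
    have h1 := one_le_padicValNat_of_dvd hne0 hferm
    have h2 : ¬ 2 ≤ padicValNat p (q ^ (p - 1) - 1) := by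
      rwa [← padicValNat_dvd_iff_le hne0]
    omega

end HodgeRepro.Lit2.Murty
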